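import Summits.SmoothPoincare4.SmoothPoincare4.Theses.EntropyRung
import Literature.Geometry.Lorentzian.Basic
import Literature.Geometry.Lorentzian.SchoenYauStableSurface

/-!
# Transplant comparison, III: transplanted functions, the inverse metric, error bookkeeping

Helper file of the stub `stub_transplantComparison` (U3) of line `collapsed-ends-usc`, crux
`EntropyRung.NoncompactShrinkerGap` (stmt-SmoothPoincare4-10868): the fact-free change of variables
under a `(1 ± η)`-transplant `N × ℝ → M` (see
`EntropyRungNoncompactShrinkerGapStubTransplantComparison.lean` for the statement and the plan).

This file: transplanting a compactly supported continuous / smooth function along a local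
homeomorphism / diffeomorphism `Φ : U → Φ U` with inverse `Ψ` (`continuous_transplant`,
`contMDiff_transplant`: `x ↦ if x ∈ Φ U then G (Ψ x) else 0`), the chain rules
`dΨ ∘ dΦ = id`, `dΦ ∘ dΨ = id` (`mfderiv_comp_mfderiv_eq_id`, `mfderiv_comp_mfderiv_eq_id'`),
elementary inverse-metric inequalities for a Riemannian `g` (`dual_apply_sq_le` from the tree's
Cauchy–Schwarz `PseudoRiemannianMetric.val_sq_le_mul`, the dual-norm comparison under a
quasi-isometric isomorphism `innerDual_comp_le`, `gradSq_eq_zero_of_notMem_tsupport`), and the real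
arithmetic of the final assembly (`functional_le_of_bounds`).

## References

* H. Federer, *Geometric Measure Theory*, Springer 1969, §3.2.3 (area formula), §3.2.46
  (Hausdorff measure of a Riemannian manifold). [Federer1969]
* I. Chavel, *Riemannian Geometry: A Modern Introduction*, 2nd ed., CUP 2006, §III.3, (III.3.6)
  (integration in local coordinates). [Chavel2006]
-/

noncomputable section

-- the prescribed namespace `Summit.<Summit>.<Problem>.…` repeats `SmoothPoincare4` (summit = problem)
set_option linter.dupNamespace false

namespace Summit.SmoothPoincare4.SmoothPoincare4.Theorems.NoncompactShrinkerGapTransplantComparison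

open scoped Manifold ContDiff ENNReal NNReal Topology Bundle
open MeasureTheory Set
open Literature.Geometry.Lorentzian Literature.Geometry.Riemannian


/-! ### Transplanting functions along a local homeomorphism / diffeomorphism -/

section Transplant

variable {X : Type*} [TopologicalSpace X] {M : Type*} [TopologicalSpace M]

open Classical in
/-- **Transplanting a compactly supported continuous function along a local homeomorphism**:
`Φ` continuous on `U ⊆ X` with open image, `Ψ` continuous on `Φ '' U` with `Ψ ∘ Φ = id` on
`U`, `G` continuous with compact `tsupport G ⊆ U`, and `M` Hausdorff. Then
`x ↦ if x ∈ Φ '' U then G (Ψ x) else 0` is continuous on `M`, agrees with `G ∘ Ψ` on `Φ '' U`,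
has `tsupport ⊆ Φ '' tsupport G` (compact), hence compact support. [folklore] -/
theorem continuous_transplant [T2Space M] {U : Set X} {Φ : X → M} {Ψ : M → X} {G : X → ℝ}
    (hΦ : ContinuousOn Φ U) (hΦU : IsOpen (Φ '' U)) (hΨ : ContinuousOn Ψ (Φ '' U))
    (hinv : ∀ p ∈ U, Ψ (Φ p) = p) (hG : Continuous G) (hGc : HasCompactSupport G)
    (hGU : tsupport G ⊆ U) :
    Continuous (fun x ↦ if x ∈ Φ '' U then G (Ψ x) else 0) ∧
    (∀ x ∈ Φ '' U, (fun x ↦ if x ∈ Φ '' U then G (Ψ x) else 0) x = G (Ψ x)) ∧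
    (∀ x ∉ Φ '' U, (fun x ↦ if x ∈ Φ '' U then G (Ψ x) else 0) x = 0) ∧
    tsupport (fun x ↦ if x ∈ Φ '' U then G (Ψ x) else 0) ⊆ Φ '' tsupport G ∧
    HasCompactSupport (fun x ↦ if x ∈ Φ '' U then G (Ψ x) else 0) := by
  set w : M → ℝ := fun x ↦ if x ∈ Φ '' U then G (Ψ x) else 0 with hw
  have hagree : ∀ x ∈ Φ '' U, w x = G (Ψ x) := fun x hx ↦ by simp only [hw, if_pos hx]
  have hzero : ∀ x ∉ Φ '' U, w x = 0 := fun x hx ↦ by simp only [hw, if_neg hx]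
  have hKc : IsCompact (Φ '' tsupport G) := hGc.image_of_continuousOn (hΦ.mono hGU)
  have hsupp : Function.support w ⊆ Φ '' tsupport G := by
    intro x hx
    rw [Function.mem_support] at hx
    by_cases hxU : x ∈ Φ '' U
    · obtain ⟨p, hp, rfl⟩ := hxU
      rw [hagree _ (mem_image_of_mem Φ hp), hinv p hp] at hx
      exact ⟨p, subset_tsupport _ (Function.mem_support.2 hx), rfl⟩
    · exact absurd (hzero x hxU) hx
  have htsupp : tsupport w ⊆ Φ '' tsupport G := closure_minimal hsupp hKc.isClosed
  have hcs : HasCompactSupport w := hKc.of_isClosed_subset (isClosed_tsupport _) htsupp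
  refine ⟨?_, hagree, hzero, htsupp, hcs⟩
  rw [continuous_iff_continuousAt]
  intro x
  by_cases hx : x ∈ Φ '' U
  · have hc : ContinuousOn w (Φ '' U) := (hG.comp_continuousOn hΨ).congr fun y hy ↦ hagree y hy
    exact hc.continuousAt (hΦU.mem_nhds hx)
  · have hx' : x ∉ tsupport w := fun h' ↦ hx (image_mono hGU (htsupp h'))
    have hev : w =ᶠ[𝓝 x] fun _ ↦ (0 : ℝ) := notMem_tsupport_iff_eventuallyEq.1 hx'
    exact (continuousAt_const : ContinuousAt (fun _ : M ↦ (0 : ℝ)) x).congr_of_eventuallyEq hev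

end Transplant

section SmoothTransplant

variable {E : Type*} [NormedAddCommGroup E] [NormedSpace ℝ E] {H : Type*} [TopologicalSpace H]
  {I : ModelWithCorners ℝ E H} {M : Type*} [TopologicalSpace M] [ChartedSpace H M]
  {E' : Type*} [NormedAddCommGroup E'] [NormedSpace ℝ E'] {H' : Type*} [TopologicalSpace H']
  {J : ModelWithCorners ℝ E' H'} {X : Type*} [TopologicalSpace X] [ChartedSpace H' X]
  {n : WithTop ℕ∞}

open Classical in
/-- **Transplanting a compactly supported smooth function along a local diffeomorphism**: with
`Φ` smooth on the open-imaged `U`, `Ψ` smooth on `Φ '' U`, `Ψ ∘ Φ = id` on `U` and `W` smooth with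
compact `tsupport W ⊆ U`, the transplant `x ↦ if x ∈ Φ '' U then W (Ψ x) else 0` is smooth.
[folklore] -/
theorem contMDiff_transplant [T2Space M] {U : Set X} {Φ : X → M} {Ψ : M → X} {W : X → ℝ}
    (hΦ : ContMDiffOn J I n Φ U) (hΦU : IsOpen (Φ '' U))
    (hΨ : ContMDiffOn I J n Ψ (Φ '' U)) (hinv : ∀ p ∈ U, Ψ (Φ p) = p)
    (hW : ContMDiff J 𝓘(ℝ, ℝ) n W) (hWc : HasCompactSupport W) (hWU : tsupport W ⊆ U) :
    ContMDiff I 𝓘(ℝ, ℝ) n (fun x ↦ if x ∈ Φ '' U then W (Ψ x) else 0) := by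
  obtain ⟨-, hagree, -, htsupp, -⟩ :=
    continuous_transplant hΦ.continuousOn hΦU hΨ.continuousOn hinv hW.continuous hWc hWU
  have hsubO : tsupport (fun x ↦ if x ∈ Φ '' U then W (Ψ x) else 0) ⊆ Φ '' U :=
    htsupp.trans (image_mono hWU)
  have hon : ContMDiffOn I 𝓘(ℝ, ℝ) n (fun x ↦ if x ∈ Φ '' U then W (Ψ x) else 0) (Φ '' U) :=
    (hW.comp_contMDiffOn hΨ).congr fun x hx ↦ hagree x hx
  exact contMDiff_of_tsupport fun x hx ↦ (hon x (hsubO hx)).contMDiffAt (hΦU.mem_nhds (hsubO hx))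

/-- **Chain rule for a local inverse**: if `Ψ ∘ Φ = id` on an open `U`, `Φ` is `Cⁿ` on `U`
(`n ≠ 0`) and `Ψ` is `Cⁿ` on the open image `Φ '' U`, then `dΨ_{Φ p} ∘ dΦ_p = id` for `p ∈ U`.
[folklore] -/
theorem mfderiv_comp_mfderiv_eq_id {U : Set X} {Φ : X → M} {Ψ : M → X} (hU : IsOpen U)
    (hΦ : ContMDiffOn J I n Φ U) (hΦU : IsOpen (Φ '' U)) (hΨ : ContMDiffOn I J n Ψ (Φ '' U))
    (hinv : ∀ p ∈ U, Ψ (Φ p) = p) (hn : n ≠ 0) {p : X} (hp : p ∈ U) :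
    (mfderiv I J Ψ (Φ p)).comp (mfderiv J I Φ p) = ContinuousLinearMap.id ℝ (TangentSpace J p) := by
  have hΦd : MDifferentiableAt J I Φ p := (hΦ.contMDiffAt (hU.mem_nhds hp)).mdifferentiableAt hn
  have hΨd : MDifferentiableAt I J Ψ (Φ p) :=
    (hΨ.contMDiffAt (hΦU.mem_nhds (mem_image_of_mem Φ hp))).mdifferentiableAt hn
  have hcomp : mfderiv J J (Ψ ∘ Φ) p = (mfderiv I J Ψ (Φ p)).comp (mfderiv J I Φ p) :=
    mfderiv_comp p hΨd hΦd
  have hev : Ψ ∘ Φ =ᶠ[𝓝 p] id :=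
    Filter.eventually_of_mem (hU.mem_nhds hp) fun q hq ↦ by simp [hinv q hq]
  rw [← hcomp, hev.mfderiv_eq, mfderiv_id]

/-- **Chain rule for a local inverse, the other composition**: under the same hypotheses
`dΦ_p ∘ dΨ_{Φ p} = id` for `p ∈ U` (`Φ ∘ Ψ = id` on the open set `Φ '' U`). [folklore] -/
theorem mfderiv_comp_mfderiv_eq_id' {U : Set X} {Φ : X → M} {Ψ : M → X} (hU : IsOpen U)
    (hΦ : ContMDiffOn J I n Φ U) (hΦU : IsOpen (Φ '' U)) (hΨ : ContMDiffOn I J n Ψ (Φ '' U))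
    (hinv : ∀ p ∈ U, Ψ (Φ p) = p) (hn : n ≠ 0) {p : X} (hp : p ∈ U) :
    (mfderiv J I Φ p).comp (mfderiv I J Ψ (Φ p)) =
      ContinuousLinearMap.id ℝ (TangentSpace I (Φ p)) := by
  have hΦd : MDifferentiableAt J I Φ p := (hΦ.contMDiffAt (hU.mem_nhds hp)).mdifferentiableAt hn
  have hΨd : MDifferentiableAt I J Ψ (Φ p) :=
    (hΨ.contMDiffAt (hΦU.mem_nhds (mem_image_of_mem Φ hp))).mdifferentiableAt hn
  have hΦd' : MDifferentiableAt J I Φ (Ψ (Φ p)) := by rw [hinv p hp]; exact hΦd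
  have hcomp : mfderiv I I (Φ ∘ Ψ) (Φ p) = (mfderiv J I Φ (Ψ (Φ p))).comp (mfderiv I J Ψ (Φ p)) :=
    mfderiv_comp (Φ p) hΦd' hΨd
  have hev : Φ ∘ Ψ =ᶠ[𝓝 (Φ p)] id := by
    filter_upwards [hΦU.mem_nhds (mem_image_of_mem Φ hp)] with x hx
    obtain ⟨q, hq, rfl⟩ := hx
    simp [hinv q hq]
  have h := hcomp
  rw [hev.mfderiv_eq, mfderiv_id] at h
  -- `h : id = dΦ_{Ψ (Φ p)} ∘ dΨ_{Φ p}`; rewrite `Ψ (Φ p) = p` through a type-constant family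
  set F : X → (TangentSpace I (Φ p) →L[ℝ] TangentSpace I (Φ p)) :=
    fun p' ↦ (mfderiv J I Φ p').comp (mfderiv I J Ψ (Φ p)) with hF
  have h2 : F (Ψ (Φ p)) = ContinuousLinearMap.id ℝ _ := h.symm
  rw [hinv p hp] at h2
  exact h2

end SmoothTransplant

/-! ### Inverse metric bookkeeping (dual norms under quasi-isometries) -/

section DualNorm

variable {E : Type*} [NormedAddCommGroup E] [NormedSpace ℝ E] {H : Type*} [TopologicalSpace H]
  {I : ModelWithCorners ℝ E H} {M : Type*} [TopologicalSpace M] [ChartedSpace H M]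
  [IsManifold I ∞ M] {n : ℕ∞ω} [FiniteDimensional ℝ E]
  (g : PseudoRiemannianMetric I n E (TangentSpace I : M → Type _))

/-- **Dual pairing bound**: `α(v)² ≤ g⁻¹(α,α) g(v,v)` (`α(v) = g(♯α, v)` and Cauchy–Schwarz).
[folklore] -/
theorem dual_apply_sq_le (hg : g.IsRiemannian) (x : M) (α : Module.Dual ℝ (TangentSpace I x))
    (v : TangentSpace I x) : α v ^ 2 ≤ g.innerDual x α α * g.val x v v := by
  rw [← PseudoRiemannianMetric.val_sharp_apply g x α v,
    PseudoRiemannianMetric.innerDual_eq_val_sharp_sharp]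
  exact g.val_sq_le_mul hg x _ _

/-- **Dual-norm comparison under a quasi-isometric isomorphism**: `A : T → T_xM` linear with
`A (B w) = w`, `c k(v) ≤ g(Av, Av)` for a function `k` on `T` and `c > 0`, and a functional `α`
on `T` with `α(v)² ≤ K k(v)`, `K ≥ 0`. Then `g⁻¹(α ∘ B, α ∘ B) ≤ K / c`. [folklore] -/
theorem innerDual_comp_le (hg : g.IsRiemannian) (x : M) {T : Type*} [AddCommGroup T]
    [Module ℝ T] (A : T →ₗ[ℝ] TangentSpace I x) (B : TangentSpace I x →ₗ[ℝ] T)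
    (hAB : ∀ w, A (B w) = w) (k : T → ℝ) {c K : ℝ} (hc : 0 < c) (hK : 0 ≤ K)
    (hA : ∀ v, c * k v ≤ g.val x (A v) (A v)) (α : T →ₗ[ℝ] ℝ) (hα : ∀ v, α v ^ 2 ≤ K * k v) :
    g.innerDual x (α ∘ₗ B) (α ∘ₗ B) ≤ K / c := by
  set β : Module.Dual ℝ (TangentSpace I x) := α ∘ₗ B with hβ
  set w : TangentSpace I x := g.sharp x β with hw
  have hX : g.innerDual x β β = g.val x w w :=
    PseudoRiemannianMetric.innerDual_eq_val_sharp_sharp g x β β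
  have hX0 : 0 ≤ g.innerDual x β β := by rw [hX]; exact g.val_self_nonneg hg x w
  have hXα : g.innerDual x β β = α (B w) := rfl
  have h1 : (g.innerDual x β β) ^ 2 ≤ K * k (B w) := hXα ▸ hα (B w)
  have h2 : K * k (B w) ≤ K / c * g.innerDual x β β := by
    rw [hX]
    have hA' := hA (B w)
    rw [hAB] at hA'
    calc K * k (B w) = K / c * (c * k (B w)) := by field_simp
      _ ≤ K / c * g.val x w w := by gcongr
  rw [le_div_iff₀ hc]
  by_cases hz : g.innerDual x β β = 0
  · rw [hz, zero_mul]; exact hK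
  · have hpos : 0 < g.innerDual x β β := lt_of_le_of_ne hX0 (Ne.symm hz)
    have h3 : (g.innerDual x β β) ^ 2 ≤ K / c * g.innerDual x β β := h1.trans h2
    have h4 : g.innerDual x β β ≤ K / c := by
      rw [sq] at h3; exact le_of_mul_le_mul_right h3 hpos
    calc g.innerDual x β β * c ≤ K / c * c := by gcongr
      _ = K := div_mul_cancel₀ K hc.ne'

/-- Off the topological support of `f`, `|∇f|²_g = 0`. [folklore] -/
theorem gradSq_eq_zero_of_notMem_tsupport {f : M → ℝ} {x : M}
    (hx : x ∉ tsupport f) : g.gradSq f x = 0 := by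
  have hev : f =ᶠ[𝓝 x] fun _ ↦ 0 := notMem_tsupport_iff_eventuallyEq.1 hx
  have h0 : mfderiv I 𝓘(ℝ, ℝ) f x = 0 := by rw [hev.mfderiv_eq, mfderiv_const]; rfl
  simp only [PseudoRiemannianMetric.gradSq, mvfderiv, h0, ContinuousLinearMap.comp_zero]
  simp [PseudoRiemannianMetric.innerDual]

end DualNorm

/-! ### The real arithmetic of the assembly -/

section Arithmetic

/-- **Error bookkeeping.** With `Z > 0`, nonnegative model integrals `aRp, aRm, aK, aLp, aLm`,
`Num = aRp - aRm + 4aK - aLp + aLm`, `C₁ = 3aRp + 2aRm + 32aK + 2aLp + 3aLm`,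
`0 < η ≤ 1/2` and `η (12|Num|/Z + 4C₁/Z + 4) ≤ ε`: if `Z_g ∈ [(1-η)²Z, (1+η)²Z]`,
`b_R ≤ (1+η)² aRp - (1-η)² aRm + η Z_g`, `b_K ≤ (1+η)²/(1-η) aK`, `b_L^± ∈ [(1-η)², (1+η)²] aL^±`,
then `(b_R + 4b_K - (b_Lp - b_Lm))/Z_g + log Z_g ≤ Num/Z + log Z + ε`. [folklore] -/
theorem functional_le_of_bounds {ε aRp aRm aK aLp aLm Z η bR bK bLp bLm Zg : ℝ}
    (haRp : 0 ≤ aRp) (haRm : 0 ≤ aRm) (haK : 0 ≤ aK) (haLp : 0 ≤ aLp) (haLm : 0 ≤ aLm)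
    (hZ : 0 < Z) (hη0 : 0 < η) (hη1 : η ≤ 1 / 2)
    (hηC : η * (12 * |aRp - aRm + 4 * aK - aLp + aLm| / Z +
      4 * (3 * aRp + 2 * aRm + 32 * aK + 2 * aLp + 3 * aLm) / Z + 4) ≤ ε)
    (hZg1 : (1 - η) ^ 2 * Z ≤ Zg) (hZg2 : Zg ≤ (1 + η) ^ 2 * Z)
    (hbR : bR ≤ (1 + η) ^ 2 * aRp - (1 - η) ^ 2 * aRm + η * Zg)
    (hbK : bK ≤ (1 + η) ^ 2 / (1 - η) * aK)
    (hbLp : (1 - η) ^ 2 * aLp ≤ bLp) (hbLm : bLm ≤ (1 + η) ^ 2 * aLm) :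
    (bR + 4 * bK - (bLp - bLm)) / Zg + Real.log Zg ≤
      (aRp - aRm + 4 * aK - (aLp - aLm)) / Z + Real.log Z + ε := by
  set Num := aRp - aRm + 4 * aK - aLp + aLm with hNum
  set C₁ := 3 * aRp + 2 * aRm + 32 * aK + 2 * aLp + 3 * aLm with hC₁
  have hC₁0 : 0 ≤ C₁ := by rw [hC₁]; linarith
  have h1η : 0 < 1 - η := by linarith
  have hη1' : η ≤ 1 := by linarith
  have hlZ : 0 < (1 - η) ^ 2 * Z := mul_pos (pow_pos h1η 2) hZ
  have hZg0 : 0 < Zg := lt_of_lt_of_le hlZ hZg1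
  have h14 : (1 : ℝ) / 4 ≤ (1 - η) ^ 2 := by
    nlinarith [mul_nonneg (by linarith : (0 : ℝ) ≤ 1 / 2 - η) (by linarith : (0 : ℝ) ≤ 3 / 2 - η)]
  have hZg4 : Z / 4 ≤ Zg := by linarith [mul_le_mul_of_nonneg_right h14 hZ.le]
  have hlp : (1 + η) ^ 2 - 1 ≤ 3 * η := by nlinarith [mul_le_mul_of_nonneg_left hη1' hη0.le]
  have hlm : 1 - (1 - η) ^ 2 ≤ 2 * η := by nlinarith [sq_nonneg η]
  have hfrac : (1 + η) ^ 2 / (1 - η) - 1 ≤ 8 * η := by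
    rw [div_sub_one h1η.ne', div_le_iff₀ h1η]
    nlinarith [mul_le_mul_of_nonneg_left hη1 hη0.le]
  -- the numerator
  have hNumg : bR + 4 * bK - (bLp - bLm) ≤ Num + η * C₁ + η * Zg := by
    have h4 : bK ≤ aK + ((1 + η) ^ 2 / (1 - η) - 1) * aK := by linarith
    have h4' : ((1 + η) ^ 2 / (1 - η) - 1) * aK ≤ 8 * η * aK :=
      mul_le_mul_of_nonneg_right hfrac haK
    have h5 := mul_le_mul_of_nonneg_right hlp haRp
    have h6 := mul_le_mul_of_nonneg_right hlm haRm
    have h7 := mul_le_mul_of_nonneg_right hlm haLp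
    have h8 := mul_le_mul_of_nonneg_right hlp haLm
    rw [hNum, hC₁]
    linarith
  have hdiv : (bR + 4 * bK - (bLp - bLm)) / Zg ≤ (Num + η * C₁) / Zg + η := by
    rw [div_add' _ _ _ hZg0.ne', div_le_div_iff_of_pos_right hZg0]
    linarith
  -- from `Z_g` to `Z` in the denominator
  have hcmp : (Num + η * C₁) / Zg ≤ Num / Z + η * (12 * |Num| / Z + 4 * C₁ / Z) := by
    have hZdiff : |Z - Zg| ≤ 3 * η * Z := by
      have h5 := mul_le_mul_of_nonneg_right hlp hZ.le
      have h6 := mul_le_mul_of_nonneg_right hlm hZ.le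
      have h7 := mul_nonneg hη0.le hZ.le
      rw [abs_le]
      constructor <;> linarith
    have hinv : |1 / Zg - 1 / Z| ≤ 12 * η / Z := by
      rw [div_sub_div _ _ hZg0.ne' hZ.ne', one_mul, mul_one, abs_div,
        abs_of_pos (mul_pos hZg0 hZ), div_le_div_iff₀ (mul_pos hZg0 hZ) hZ]
      have h3 : 0 ≤ 3 * η * Z := by positivity
      have h8 := mul_le_mul_of_nonneg_left (by linarith : Z ≤ 4 * Zg) h3
      calc |Z - Zg| * Z ≤ 3 * η * Z * Z := by gcongr
        _ ≤ 3 * η * Z * (4 * Zg) := h8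
        _ = 12 * η * (Zg * Z) := by ring
    have hterm1 : Num * (1 / Zg - 1 / Z) ≤ |Num| * (12 * η / Z) := by
      calc Num * (1 / Zg - 1 / Z) ≤ |Num * (1 / Zg - 1 / Z)| := le_abs_self _
        _ = |Num| * |1 / Zg - 1 / Z| := abs_mul _ _
        _ ≤ |Num| * (12 * η / Z) := by gcongr
    have hterm2 : η * C₁ / Zg ≤ η * C₁ / (Z / 4) :=
      div_le_div_of_nonneg_left (mul_nonneg hη0.le hC₁0) (div_pos hZ (by norm_num)) hZg4
    have hexp : (Num + η * C₁) / Zg = Num / Z + Num * (1 / Zg - 1 / Z) + η * C₁ / Zg := by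
      field_simp; ring
    have e1 : |Num| * (12 * η / Z) = η * (12 * |Num| / Z) := by ring
    have e2 : η * C₁ / (Z / 4) = η * (4 * C₁ / Z) := by
      field_simp
    have e3 : η * (12 * |Num| / Z + 4 * C₁ / Z) = η * (12 * |Num| / Z) + η * (4 * C₁ / Z) := by
      ring
    rw [hexp, e3]
    linarith [hterm1, hterm2, e1, e2]
  -- the logarithm
  have hlog : Real.log Zg ≤ Real.log Z + 3 * η := by
    have h1 : Real.log Zg ≤ Real.log ((1 + η) ^ 2 * Z) := Real.log_le_log hZg0 hZg2
    rw [Real.log_mul (by positivity) hZ.ne'] at h1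
    have h2 : Real.log ((1 + η) ^ 2) ≤ (1 + η) ^ 2 - 1 := Real.log_le_sub_one_of_pos (by positivity)
    linarith
  have htot : η * (12 * |Num| / Z + 4 * C₁ / Z) + η + 3 * η ≤ ε := by
    have : η * (12 * |Num| / Z + 4 * C₁ / Z) + η + 3 * η =
        η * (12 * |Num| / Z + 4 * C₁ / Z + 4) := by ring
    rw [this]; exact hηC
  have hNumeq : aRp - aRm + 4 * aK - (aLp - aLm) = Num := by rw [hNum]; ring
  rw [hNumeq]
  linarith [hdiv, hcmp, hlog, htot]

end Arithmetic

/-! ### The registered sub-goal of this file -/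

/-- **Registered sub-goal `stub_transplantErrorBookkeeping`** (the error bookkeeping of the
assembly — the statement of `functional_le_of_bounds` with all binders explicit). [folklore] -/
theorem stub_transplantErrorBookkeeping : ∀ (ε aRp aRm aK aLp aLm Z η bR bK bLp bLm Zg : ℝ), 0 ≤ aRp → 0 ≤ aRm → 0 ≤ aK → 0 ≤ aLp → 0 ≤ aLm → 0 < Z → 0 < η → η ≤ 1 / 2 → η * (12 * |aRp - aRm + 4 * aK - aLp + aLm| / Z + 4 * (3 * aRp + 2 * aRm + 32 * aK + 2 * aLp + 3 * aLm) / Z + 4) ≤ ε → (1 - η) ^ 2 * Z ≤ Zg → Zg ≤ (1 + η) ^ 2 * Z → bR ≤ (1 + η) ^ 2 * aRp - (1 - η) ^ 2 * aRm + η * Zg → bK ≤ (1 + η) ^ 2 / (1 - η) * aK → (1 - η) ^ 2 * aLp ≤ bLp → bLm ≤ (1 + η) ^ 2 * aLm → (bR + 4 * bK - (bLp - bLm)) / Zg + Real.log Zg ≤ (aRp - aRm + 4 * aK - (aLp - aLm)) / Z + Real.log Z + ε := by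
  intro ε aRp aRm aK aLp aLm Z η bR bK bLp bLm Zg haRp haRm haK haLp haLm hZ hη0 hη1 hηC hZg1 hZg2 hbR hbK hbLp hbLm
  exact functional_le_of_bounds haRp haRm haK haLp haLm hZ hη0 hη1 hηC hZg1 hZg2 hbR hbK hbLp hbLm

end Summit.SmoothPoincare4.SmoothPoincare4.Theorems.NoncompactShrinkerGapTransplantComparison
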